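import Summits.HubbardSuperconductivity.HubbardSuperconductivity.Theorems.AnisotropyChordDressHalfFilledSecondOrderUpper
import Summits.HubbardSuperconductivity.HubbardSuperconductivity.Theorems.AnisotropyChordDressHalfFilledConcentrationLemmas
import Summits.HubbardSuperconductivity.HubbardSuperconductivity.Theorems.LevyLogBootstrapDressHalfFilledDictionaryPairField
import Literature.MathematicalPhysics.QuantumLattice.LTQOProofs
import Literature.MathematicalPhysics.QuantumLattice.SpinChainsLiebMattisProofs
import HarnessLib

/-!
# Crux `DressHalfFilled` (stmt-HubbardSuperconductivity-8148, routes `AnisotropyChord` / `LevyLogBootstrap`), stub 3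
# `stub_dressHalfFilled`: ORDER INHERITANCE THROUGH THE DICTIONARY NEAR THE XXZ GROUND MULTIPLET

Helper file (`--supports stmt-HubbardSuperconductivity-8148`). The last GENERIC step of the fixed-`L` concentration argument: a fermion
state of the form `Φφ + r` — `Φ = dictionaryMap M U`, `φ` in the half-filled boson sector `S^z_tot = 0`, `r` any remainder — carries
`d`-wave pair-field order at least `½·c(U)²·c_Λ·Re⟨φ, P_E φ⟩ − Re⟨r', Δ_d†Δ_d r'⟩`, where `P_E` is the orthogonal projection onto the
ground multiplet `E = (S^z_tot = 0) ⊓ ker(H_M(Δ) − e)` of ANY Hermitian spin operator `H` commuting setup (used with `H = H_M(Δ_eff)`),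
`c_Λ` is a lower bound for the planar order `Λ = Re⟨·, S⁺_tot S⁻_tot ·⟩` on the unit vectors of `E` (for `H = H_M(Δ_eff)`,
`e = lowestEnergyInSector`, this is exactly what `HalfFilledOrder` provides: `c_Λ = c(Δ_eff)·M⁴`), and `r' = Φ(φ − P_E φ) + r`.

* `raiseLower_form_smul` — `Λ(a • v) = |a|²·Λ(v)`;
* `raiseLower_form_ge_of_unit_bound` — a bound `c_Λ ≤ Λ(ψ₀)` on unit vectors of a set of states gives `c_Λ‖v‖² ≤ Λ(v)` on all of them;
* `order_ge_near_groundMultiplet` — **the inheritance inequality** above (ingredients: `re_form_conjTranspose_mul_self_add_ge`,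
  `DressZero.order_ge_of_pullback` with the concrete clause (e) `dictionaryMap_conjTranspose_mul_pairField_mul`, and
  `‖P_E φ‖² = Re⟨φ, P_E φ⟩`).

With `…SecondOrderTransverse` (‖r‖² = ‖ψ − Pψ‖² = O(t'²)), `…SecondOrderSelection` + `defect_le_of_rayleigh_le` (‖φ − P_Eφ‖² = O(t')) and a
form bound for `Δ_d†Δ_d`, this yields the anchor at fixed `L` with `t₀ = t₀(L)`; the assembly and, above all, uniformity in `L` remain.
HONEST LABEL: no crux and no summit statement is proved. Sources: W.-F. Tsai, S. A. Kivelson, PRB 73 (2006) 214510, App. A [TsaiKivelson2006];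
T. Kato (1966) II-§2.3. No definition and no named fact is introduced; sorry-free.
-/

noncomputable section

-- `dupNamespace`: the summit and the problem are both named `HubbardSuperconductivity` (layout D-0022)
set_option linter.dupNamespace false

namespace Summit.HubbardSuperconductivity.HubbardSuperconductivity.Theorems.AnisotropyChord.DressSecond

open Matrix Literature.MathematicalPhysics.QuantumLattice Literature.Probability.LatticeModels
open Literature.MathematicalPhysics.QuantumLattice.TorusPlaquette
open Summit.HubbardSuperconductivity.HubbardSuperconductivity.Theorems.LevyLogBootstrap (dictionaryMap_conjTranspose_mul_pairField_mul)
open scoped ComplexOrder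

section Spin

variable {n : Type*} [Fintype n] [DecidableEq n]

omit [DecidableEq n] in
/-- A Hermitian-form value scales quadratically: `Re⟨a•v, B(a•v)⟩ = (Re⟨v,v⟩-normalised) |a|² Re⟨v, Bv⟩` for real `a`. [folklore] -/
theorem re_form_real_smul (B : Matrix n n ℂ) (a : ℝ) (v : n → ℂ) :
    (star ((a : ℂ) • v) ⬝ᵥ (B *ᵥ ((a : ℂ) • v))).re = a ^ 2 * (star v ⬝ᵥ (B *ᵥ v)).re := by
  rw [mulVec_smul, star_smul, smul_dotProduct, dotProduct_smul, Complex.star_def, Complex.conj_ofReal, smul_eq_mul,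
    smul_eq_mul, ← mul_assoc, ← Complex.ofReal_mul, Complex.re_ofReal_mul, sq]

/-- **From unit vectors to all vectors.** If `c ≤ Re⟨ψ₀, B ψ₀⟩` for every UNIT vector `ψ₀` of a set of states closed under real
scaling (here: an eigenspace inside a sector), then `c·‖v‖² ≤ Re⟨v, B v⟩` for every `v` in it. [folklore] -/
theorem re_form_ge_of_unit_bound (B : Matrix n n ℂ) {S : Set (n → ℂ)} (hS : ∀ (a : ℝ) (v : n → ℂ), v ∈ S → (a : ℂ) • v ∈ S)
    {c : ℝ} (hc : ∀ ψ₀ ∈ S, star ψ₀ ⬝ᵥ ψ₀ = 1 → c ≤ (star ψ₀ ⬝ᵥ (B *ᵥ ψ₀)).re)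
    {v : n → ℂ} (hv : v ∈ S) :
    c * (star v ⬝ᵥ v).re ≤ (star v ⬝ᵥ (B *ᵥ v)).re := by
  by_cases hv0 : (star v ⬝ᵥ v).re = 0
  · -- `v = 0`
    have hvz : v = 0 := by
      have h1 : star v ⬝ᵥ v = 0 := by rw [star_dotProduct_self_eq_re v, hv0, Complex.ofReal_zero]
      exact dotProduct_star_self_eq_zero.1 h1
    rw [hvz, mulVec_zero, dotProduct_zero, Complex.zero_re, mul_zero]
  · set ρ : ℝ := (star v ⬝ᵥ v).re with hρ
    have hρ0 : 0 < ρ := lt_of_le_of_ne (Complex.nonneg_iff.mp (dotProduct_star_self_nonneg v)).1 (Ne.symm hv0)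
    set a : ℝ := (Real.sqrt ρ)⁻¹ with ha
    have ha2 : a ^ 2 * ρ = 1 := by
      rw [ha, inv_pow, Real.sq_sqrt hρ0.le, inv_mul_cancel₀ hρ0.ne']
    have hunit : star ((a : ℂ) • v) ⬝ᵥ ((a : ℂ) • v) = 1 := by
      have h := re_form_real_smul (1 : Matrix n n ℂ) a v
      rw [one_mulVec, one_mulVec] at h
      rw [star_dotProduct_self_eq_re, h, ← hρ, ha2, Complex.ofReal_one]
    have h := hc _ (hS a v hv) hunit
    rw [re_form_real_smul] at h
    -- `c ≤ a² Re⟨v,Bv⟩` with `a² ρ = 1`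
    have : c * ρ ≤ a ^ 2 * ρ * (star v ⬝ᵥ (B *ᵥ v)).re := by nlinarith
    rw [ha2, one_mul] at this
    exact this

end Spin

section Plaquette

variable {M : ℕ} [NeZero M]

set_option linter.style.longLine false in
/-- **Order inheritance through the dictionary.** `M ≥ 2`, `Φ = dictionaryMap M U`, `H` any matrix on the spin space (used with
`H = H_M(Δ_eff)`), `e : ℝ`, `E = (S^z_tot = 0) ⊓ ker(H − e)` with orthogonal projection `P_E`; assume the planar order bound
`c_Λ ≤ Re⟨ψ₀, S⁺_tot S⁻_tot ψ₀⟩` for every unit `ψ₀ ∈ E`. Then for every spin vector `φ` and every fermion vector `r`: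
`½·c(U)²·c_Λ·Re⟨φ, P_E φ⟩ − Re⟨r', Δ_d†Δ_d r'⟩ ≤ Re⟨Φφ + r, Δ_d†Δ_d (Φφ + r)⟩`, `r' = Φ(φ − P_Eφ) + r`.
Tsai–Kivelson (2006) App. A; elementary. [folklore] -/
theorem order_ge_near_groundMultiplet (hM : 2 ≤ M) (U : ℝ) (H : Matrix (TensorIndex (TorusSite 2 M) 2) (TensorIndex (TorusSite 2 M) 2) ℂ)
    (e cΛ : ℝ)
    (hΛ : ∀ ψ₀ : TensorIndex (TorusSite 2 M) 2 → ℂ,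
      ψ₀ ∈ spinZSector (Λ := TorusSite 2 M) 1 0 ⊓ Module.End.eigenspace (Matrix.toLin' H) (e : ℂ) → star ψ₀ ⬝ᵥ ψ₀ = 1 →
        cΛ ≤ (star ψ₀ ⬝ᵥ Matrix.mulVec ((∑ x : TorusSite 2 M, onSite x (spinRaise 1)) *
          (∑ y : TorusSite 2 M, onSite y (spinLower 1))) ψ₀).re)
    (φ : TensorIndex (TorusSite 2 M) 2 → ℂ) (r : Fock (Orb (FermionTorus 2 (2 * M)))) :
    1 / 2 * ((plaquettePairCouplings U).c ^ 2 * (cΛ *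
        (star φ ⬝ᵥ (projMatrix ((spinZSector (Λ := TorusSite 2 M) 1 0 ⊓ Module.End.eigenspace (Matrix.toLin' H) (e : ℂ)).map
          ((WithLp.linearEquiv 2 ℂ (TensorIndex (TorusSite 2 M) 2 → ℂ)).symm :
            (TensorIndex (TorusSite 2 M) 2 → ℂ) →ₗ[ℂ] EuclideanSpace ℂ (TensorIndex (TorusSite 2 M) 2))) *ᵥ φ)).re)) -
      (star (dictionaryMap M U *ᵥ (φ - projMatrix ((spinZSector (Λ := TorusSite 2 M) 1 0 ⊓
            Module.End.eigenspace (Matrix.toLin' H) (e : ℂ)).map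
          ((WithLp.linearEquiv 2 ℂ (TensorIndex (TorusSite 2 M) 2 → ℂ)).symm :
            (TensorIndex (TorusSite 2 M) 2 → ℂ) →ₗ[ℂ] EuclideanSpace ℂ (TensorIndex (TorusSite 2 M) 2))) *ᵥ φ) + r) ⬝ᵥ
        (((pairField dWaveFormFactor (2 * M))ᴴ * pairField dWaveFormFactor (2 * M)) *ᵥ
          (dictionaryMap M U *ᵥ (φ - projMatrix ((spinZSector (Λ := TorusSite 2 M) 1 0 ⊓
              Module.End.eigenspace (Matrix.toLin' H) (e : ℂ)).map
            ((WithLp.linearEquiv 2 ℂ (TensorIndex (TorusSite 2 M) 2 → ℂ)).symm :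
              (TensorIndex (TorusSite 2 M) 2 → ℂ) →ₗ[ℂ] EuclideanSpace ℂ (TensorIndex (TorusSite 2 M) 2))) *ᵥ φ) + r))).re ≤
      (star (dictionaryMap M U *ᵥ φ + r) ⬝ᵥ
        (((pairField dWaveFormFactor (2 * M))ᴴ * pairField dWaveFormFactor (2 * M)) *ᵥ (dictionaryMap M U *ᵥ φ + r))).re := by
  set E : Submodule ℂ (TensorIndex (TorusSite 2 M) 2 → ℂ) :=
    spinZSector (Λ := TorusSite 2 M) 1 0 ⊓ Module.End.eigenspace (Matrix.toLin' H) (e : ℂ) with hE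
  set P : Matrix (TensorIndex (TorusSite 2 M) 2) (TensorIndex (TorusSite 2 M) 2) ℂ :=
    projMatrix (E.map ((WithLp.linearEquiv 2 ℂ (TensorIndex (TorusSite 2 M) 2 → ℂ)).symm :
      (TensorIndex (TorusSite 2 M) 2 → ℂ) →ₗ[ℂ] EuclideanSpace ℂ (TensorIndex (TorusSite 2 M) 2))) with hP
  have hPh : P.IsHermitian := projMatrix_isHermitian _
  have hPP : P * P = P := projMatrix_mul_self _
  set p₀ := P *ᵥ φ with hp₀
  have hp₀E : p₀ ∈ E := projMatrix_map_mulVec_mem E φ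
  have hp₀K : p₀ ∈ spinZSector (Λ := TorusSite 2 M) 1 0 := (Submodule.mem_inf.mp hp₀E).1
  -- the splitting `Φφ + r = Φ p₀ + r'`
  have hsplit : dictionaryMap M U *ᵥ φ + r = dictionaryMap M U *ᵥ p₀ + (dictionaryMap M U *ᵥ (φ - p₀) + r) := by
    rw [mulVec_sub]; abel
  rw [hsplit]
  have hinh := re_form_conjTranspose_mul_self_add_ge (pairField dWaveFormFactor (2 * M)) (dictionaryMap M U *ᵥ p₀)
    (dictionaryMap M U *ᵥ (φ - p₀) + r)
  -- the order of the main part: `c² Λ(p₀) ≤ Re⟨Φp₀, O Φp₀⟩` (compression by the isometry `Φ`, clause (e), `su(2)` on `S^z = 0`;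
  -- the argument of `…ZerothOrder.DressZero.order_ge_of_pullback`, redone here to keep this file out of the route-file cone)
  have hmain : (plaquettePairCouplings U).c ^ 2 *
      (star p₀ ⬝ᵥ Matrix.mulVec ((∑ x : TorusSite 2 M, onSite x (spinRaise 1)) *
        (∑ y : TorusSite 2 M, onSite y (spinLower 1))) p₀).re ≤
      (star (dictionaryMap M U *ᵥ p₀) ⬝ᵥ
        (((pairField dWaveFormFactor (2 * M))ᴴ * pairField dWaveFormFactor (2 * M)) *ᵥ (dictionaryMap M U *ᵥ p₀))).re := by
    set Φ := dictionaryMap M U with hΦdef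
    set A := pairField dWaveFormFactor (2 * M) with hAdef
    have hiso : Φᴴ * Φ = 1 := dictionaryMap_conjTranspose_mul_self U
    have he : Φᴴ * A * Φ = (((plaquettePairCouplings U).c : ℝ) : ℂ) • ∑ R : TorusSite 2 M, onSite R (spinRaise 1) :=
      dictionaryMap_conjTranspose_mul_pairField_mul hM U
    -- `Re⟨w, AᴴA w⟩ = ‖A w‖²` and compression by the isometry: `‖Φᴴ w‖² ≤ ‖w‖²`
    have hformg : ∀ w : Fock (Orb (FermionTorus 2 (2 * M))),
        star w ⬝ᵥ ((Aᴴ * A) *ᵥ w) = star (A *ᵥ w) ⬝ᵥ (A *ᵥ w) := by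
      intro w
      rw [← mulVec_mulVec, star_mulVec, ← dotProduct_mulVec]
    have hcomp : ∀ w : Fock (Orb (FermionTorus 2 (2 * M))),
        (star (Φᴴ *ᵥ w) ⬝ᵥ (Φᴴ *ᵥ w)).re ≤ (star w ⬝ᵥ w).re := by
      intro w
      have h1 : star w ⬝ᵥ (Φ *ᵥ (Φᴴ *ᵥ w)) = star (Φᴴ *ᵥ w) ⬝ᵥ (Φᴴ *ᵥ w) := by
        rw [star_mulVec, ← dotProduct_mulVec, conjTranspose_conjTranspose]
      have h2 : star (Φ *ᵥ (Φᴴ *ᵥ w)) ⬝ᵥ w = star (Φᴴ *ᵥ w) ⬝ᵥ (Φᴴ *ᵥ w) := by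
        rw [star_mulVec, ← dotProduct_mulVec]
      have h3 : star (Φ *ᵥ (Φᴴ *ᵥ w)) ⬝ᵥ (Φ *ᵥ (Φᴴ *ᵥ w)) = star (Φᴴ *ᵥ w) ⬝ᵥ (Φᴴ *ᵥ w) := by
        rw [star_mulVec, ← dotProduct_mulVec, mulVec_mulVec, hiso, one_mulVec]
      have hexp : star (w - Φ *ᵥ (Φᴴ *ᵥ w)) ⬝ᵥ (w - Φ *ᵥ (Φᴴ *ᵥ w)) =
          star w ⬝ᵥ w - star (Φᴴ *ᵥ w) ⬝ᵥ (Φᴴ *ᵥ w) := by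
        rw [star_sub, sub_dotProduct, dotProduct_sub, dotProduct_sub, h1, h2, h3]; ring
      have h0 : 0 ≤ (star (w - Φ *ᵥ (Φᴴ *ᵥ w)) ⬝ᵥ (w - Φ *ᵥ (Φᴴ *ᵥ w))).re :=
        (Complex.nonneg_iff.mp (dotProduct_star_self_nonneg _)).1
      rw [hexp, Complex.sub_re] at h0
      linarith
    have h0 := hcomp (A *ᵥ (Φ *ᵥ p₀))
    -- `Φᴴ v = c • S⁺ p₀`
    have hw : Φᴴ *ᵥ (A *ᵥ (Φ *ᵥ p₀)) =
        (((plaquettePairCouplings U).c : ℝ) : ℂ) • (raiseOn 1 (Finset.univ : Finset (TorusSite 2 M)) *ᵥ p₀) := by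
      rw [mulVec_mulVec, mulVec_mulVec, he, smul_mulVec]; rfl
    -- `‖c S⁺ p₀‖² = c² ⟨p₀, S⁻S⁺ p₀⟩ = c² ⟨p₀, S⁺S⁻ p₀⟩` on the sector `S^z = 0`
    have hsu2 := isSu2Triple_on 1 (Finset.univ : Finset (TorusSite 2 M))
    have hZ : zOn 1 Finset.univ *ᵥ p₀ = 0 := by
      rw [(mem_spinZSector_iff_mulVec 1 0 p₀).1 hp₀K]; simp
    have hLP : star (raiseOn 1 (Finset.univ : Finset (TorusSite 2 M)) *ᵥ p₀) ⬝ᵥ (raiseOn 1 Finset.univ *ᵥ p₀) =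
        star p₀ ⬝ᵥ ((raiseOn 1 Finset.univ * lowerOn 1 Finset.univ) *ᵥ p₀) := by
      rw [hsu2.star_P_mulVec_dotProduct, mulVec_mulVec, hsu2.PM, add_mulVec, add_mulVec, hZ, add_zero, add_zero]
    have hPL : (raiseOn 1 (Finset.univ : Finset (TorusSite 2 M)) * lowerOn 1 Finset.univ) =
        ((∑ x : TorusSite 2 M, onSite x (spinRaise 1)) * (∑ y : TorusSite 2 M, onSite y (spinLower 1))) := rfl
    have hnormw : (star (Φᴴ *ᵥ (A *ᵥ (Φ *ᵥ p₀))) ⬝ᵥ (Φᴴ *ᵥ (A *ᵥ (Φ *ᵥ p₀)))).re = (plaquettePairCouplings U).c ^ 2 *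
        (star p₀ ⬝ᵥ Matrix.mulVec ((∑ x : TorusSite 2 M, onSite x (spinRaise 1)) *
          (∑ y : TorusSite 2 M, onSite y (spinLower 1))) p₀).re := by
      rw [hw, star_smul, smul_dotProduct, dotProduct_smul, hLP, hPL, Complex.star_def, Complex.conj_ofReal, smul_eq_mul,
        smul_eq_mul, ← mul_assoc, ← Complex.ofReal_mul, Complex.re_ofReal_mul, sq]
    rw [hformg (Φ *ᵥ p₀), ← hnormw]
    exact h0
  -- `Λ(p₀) ≥ c_Λ ‖p₀‖²`
  have hS : ∀ (a : ℝ) (v : TensorIndex (TorusSite 2 M) 2 → ℂ), v ∈ (E : Set _) → (a : ℂ) • v ∈ (E : Set _) :=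
    fun a v hv => E.smul_mem _ hv
  have hΛp₀ := re_form_ge_of_unit_bound ((∑ x : TorusSite 2 M, onSite x (spinRaise 1)) *
      (∑ y : TorusSite 2 M, onSite y (spinLower 1))) hS (fun ψ₀ hψ₀ h1 => hΛ ψ₀ hψ₀ h1) hp₀E
  -- `‖p₀‖² = Re⟨φ, P φ⟩`
  have hnorm : star p₀ ⬝ᵥ p₀ = star φ ⬝ᵥ (P *ᵥ φ) := by
    rw [hp₀, star_mulVec, ← dotProduct_mulVec, hPh.eq, mulVec_mulVec, hPP]
  rw [hnorm] at hΛp₀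
  have hc2 : 0 ≤ (plaquettePairCouplings U).c ^ 2 := sq_nonneg _
  have h1 : (plaquettePairCouplings U).c ^ 2 * (cΛ * (star φ ⬝ᵥ (P *ᵥ φ)).re) ≤
      (plaquettePairCouplings U).c ^ 2 * (star p₀ ⬝ᵥ Matrix.mulVec ((∑ x : TorusSite 2 M, onSite x (spinRaise 1)) *
          (∑ y : TorusSite 2 M, onSite y (spinLower 1))) p₀).re :=
    mul_le_mul_of_nonneg_left hΛp₀ hc2
  linarith

end Plaquette

end Summit.HubbardSuperconductivity.HubbardSuperconductivity.Theorems.AnisotropyChord.DressSecond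

end
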